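import Literature.Analysis.FluidPDE.TypeIAncientMildClassical
import Literature.Analysis.FluidPDE.CurlFreeLiouville
import Literature.Analysis.FluidPDE.TsaiMaximumPrinciple
import Summits.NavierStokesRegularity.NavierStokesRegularity.Theorems.SqueezeCycleExtremalBiaxialitySubcriticalGaugeStrainBound
import Summits.NavierStokesRegularity.NavierStokesRegularity.Theorems.SqueezeCycleMustSqueezeSimDictionary
import HarnessLib

/-!
# Route `SqueezeCycle`, crux `ExtremalBiaxialitySubcritical` — no slack in the Leray-gauge
# stretching rate (line `oseen-shell-polar-tomography`, stub `stub_noSlackStretching`)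

Stub file for item `stmt-NavierStokesRegularity-11609`
(`Summit.NavierStokesRegularity.NavierStokesRegularity.Theses.SqueezeCycle.ExtremalBiaxialitySubcritical`).
`stub_noSlackStretching`: an element `u` of the Type-I KNSS-mild class `IsTypeIAncientMild C u`
whose gauge stretching rate `(−t)⟪∇u(t,x)e, e⟫` is `≤ 1 − ε` for all `t < 0`, `x`, unit `e`
(`ε > 0`) vanishes. Proof in backward similarity variables (`U = lerayOrbit u`,
`Ω = lerayVorticity u`, `Ω(s,y) = (−t)ω(t,x)`, `x = √(−t)y`, `t = −e^{−s}`): `Ω` solves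
`∂ₛΩ + Ω + ½(y·∇)Ω + (U·∇)Ω = (Ω·∇)U + ΔΩ` (`IsTypeIAncientMild.lerayVorticity_eq`) and the
hypothesis reads `⟪∇U v, v⟫ ≤ (1 − ε)‖v‖²`, so `w = e^{2εs}‖Ω‖²` is a subsolution of
`∂ₛ + (U + ½y)·∇ − Δ` (`noSlack_subsolution`); `‖U‖ ≤ C` and `‖Ω‖ ≤ ‖curl‖K₀` by the class-uniform
gauge gradient bound (`exists_gauge_norm_fderiv_le_of_typeI`, KNSS 2009 Prop. 4.1/(4.10)), so
`w` is bounded and the drift is confining (`⟪U + ½y, y⟫ ≥ −C²/2`); the weak maximum principle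
on slabs `[s₁, s] × ℝ³` (`slab_max_principle`: quadratic penalisation `w − δ(‖y‖² + K'(s − s₁))`,
first/second-order conditions at an attained maximum) gives `w(s,·) ≤ e^{2εs₁}(‖curl‖K₀)² → 0`
(`s₁ → −∞`); so `curl u ≡ 0`, bounded div/curl-free slices are constant
(`eq_of_curl_eq_zero_of_isDivFree_of_bounded`, KNSS Lemma 3.1) and slice-constant elements vanish
in the KNSS gauge (`IsTypeIAncientMild.eq_zero_of_slice_const`, KNSS Remark 6.1).
Source: Koch–Nadirashvili–Seregin–Šverák, Acta Math. 203 (2009) = arXiv:0709.3599v1, Prop. 4.1,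
Lemma 3.1, Remark 6.1, proof of Thm. 5.1 (p. 9: the vorticity maximum-principle argument).
-/

noncomputable section

open Set Filter Topology InnerProductSpace Function Metric
open scoped RealInnerProductSpace Laplacian ContDiff

namespace Summit.NavierStokesRegularity.NavierStokesRegularity.Theorems

open Literature.Analysis Literature.Analysis.FluidPDE

set_option linter.dupNamespace false -- the doubled `NavierStokesRegularity` namespace is the tree's convention

section Generic

variable {E : Type*} [NormedAddCommGroup E] [InnerProductSpace ℝ E]

/-- `d/ds (e^{as}‖f(s)‖²) = a e^{as}‖f‖² + 2e^{as}⟪f, f'⟫`. [folklore] -/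
theorem hasDerivAt_exp_mul_norm_sq {f : ℝ → E} {f' : E} {s : ℝ} (a : ℝ) (hf : HasDerivAt f f' s) :
    HasDerivAt (fun σ => Real.exp (a * σ) * ‖f σ‖ ^ 2)
      (a * Real.exp (a * s) * ‖f s‖ ^ 2 + Real.exp (a * s) * (2 * ⟪f s, f'⟫)) s := by
  have he : HasDerivAt (fun σ => Real.exp (a * σ)) (Real.exp (a * s) * (a * 1)) s :=
    (Real.hasDerivAt_exp (a * s)).comp s ((hasDerivAt_id' s).const_mul a)
  exact (he.mul hf.norm_sq).congr_deriv (by ring)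

/-- `D(c‖f‖²)(y)[v] = 2c⟪f(y), Df(y)v⟫`. [folklore] -/
theorem fderiv_const_mul_norm_sq_apply {f : E → E} {y : E} (c : ℝ) (hf : DifferentiableAt ℝ f y)
    (v : E) : fderiv ℝ (fun z => c * ‖f z‖ ^ 2) y v = c * (2 * ⟪f y, fderiv ℝ f y v⟫) := by
  rw [((hf.hasFDerivAt.norm_sq).const_mul c).fderiv]
  simp [two_smul]
  ring

/-- One-sided Fermat at a right end point: `f ≤ f s` on `[s₁, s]`, `s₁ < s` ⇒ `0 ≤ f'(s)`.
[folklore] -/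
theorem deriv_nonneg_of_isMaxOn_Icc {f : ℝ → ℝ} {s₁ s f' : ℝ} (hlt : s₁ < s)
    (hmax : ∀ σ ∈ Icc s₁ s, f σ ≤ f s) (hf : HasDerivAt f f' s) : 0 ≤ f' := by
  have hloc : IsLocalMaxOn f (Icc s₁ s) s :=
    Filter.eventually_inf_principal.2 (Filter.Eventually.of_forall fun σ hσ => hmax σ hσ)
  have key := hloc.hasFDerivWithinAt_nonpos (hasDerivAt_iff_hasFDerivAt.1 hf).hasFDerivWithinAt
    (sub_mem_posTangentConeAt_of_segment_subset
      ((convex_Icc s₁ s).segment_subset (right_mem_Icc.2 hlt.le) (left_mem_Icc.2 hlt.le)))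
  rw [ContinuousLinearMap.toSpanSingleton_apply, smul_eq_mul] at key
  nlinarith

variable [FiniteDimensional ℝ E]

/-- `Δ(c‖f‖²)(y) = c(2⟪Δf, f⟫ + 2|Df|²_F)` for `f ∈ C²` (`laplacian_inner_self_eq`). [folklore] -/
theorem laplacian_const_mul_norm_sq {f : E → E} (c : ℝ) (hf : ContDiff ℝ 2 f) (y : E) :
    (Δ fun z => c * ‖f z‖ ^ 2) y =
      c * (2 * ⟪(Δ f) y, f y⟫ + 2 * frobeniusNormSq (fderiv ℝ f y)) := by
  have e1 : (fun z => c * ‖f z‖ ^ 2) = c • fun z => ⟪f z, f z⟫ := by funext z; simp [smul_eq_mul]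
  rw [e1, laplacian_smul _ ((hf.inner ℝ hf).contDiffAt), laplacian_inner_self_eq hf, smul_eq_mul]

/-- `Δ‖y‖²` is the constant `2|id|²_F` (`= 2 dim E`). [folklore] -/
theorem laplacian_norm_sq_eq_const (x : E) :
    (Δ fun y : E => ‖y‖ ^ 2) x = 2 * frobeniusNormSq (ContinuousLinearMap.id ℝ E) := by
  have h : (fun y : E => ‖y‖ ^ 2) = fun y : E => ⟪y, y⟫ := by
    funext y; rw [real_inner_self_eq_norm_sq]
  rw [h, laplacian_inner_self_eq (U := fun y : E => y) contDiff_id x, laplacian_id_eq_zero,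
    inner_zero_left, mul_zero, zero_add, fderiv_fun_id]

/-- **Weak maximum principle on a slab `[s₁, s₂] × E`** for a function `w` continuous on the slab,
`C²` in space and differentiable in time on `(s₁, s₂]`, bounded above by `A`, with
`∂ₛw + Dw[b] − Δw ≤ 0` there and a confining drift, `⟪b(s,y), y⟫ ≥ −K`: then
`w ≤ sup w(s₁, ·)` on the slab. Quadratic penalisation `v = w − δ(‖y‖² + K'(s − s₁))`,
`K' = 2|K| + Δ‖y‖² + 1`: `v` attains its maximum over the slab (it tends to `−∞` in space),
and at a maximum with `s > s₁` the conditions `∇v = 0`, `Δv ≤ 0`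
(`laplacian_nonpos_of_isLocalMax`), `∂ₛv ≥ 0` contradict the strict subsolution inequality;
then `δ → 0` (Protter–Weinberger Ch. 3; Gilbarg–Trudinger §3.1). [folklore] -/
theorem slab_max_principle {w : ℝ → E → ℝ} {b : ℝ → E → E} {s₁ s₂ A K M₁ : ℝ}
    (hcont : ContinuousOn (uncurry w) (Icc s₁ s₂ ×ˢ univ))
    (hC2 : ∀ s ∈ Ioc s₁ s₂, ContDiff ℝ 2 (w s))
    (hdiff : ∀ s ∈ Ioc s₁ s₂, ∀ y, DifferentiableAt ℝ (fun σ => w σ y) s)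
    (hsub : ∀ s ∈ Ioc s₁ s₂, ∀ y,
      deriv (fun σ => w σ y) s + fderiv ℝ (w s) y (b s y) - (Δ (w s)) y ≤ 0)
    (hdrift : ∀ s ∈ Ioc s₁ s₂, ∀ y, -K ≤ ⟪b s y, y⟫) (hA : ∀ s ∈ Icc s₁ s₂, ∀ y, w s y ≤ A)
    (hM₁ : ∀ y, w s₁ y ≤ M₁) : ∀ s ∈ Icc s₁ s₂, ∀ y, w s y ≤ M₁ := by
  intro s hs y
  by_contra hlt
  push Not at hlt
  -- constants: `Δ‖y‖² = D`, `K' = 2|K| + D + 1`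
  set D : ℝ := 2 * frobeniusNormSq (ContinuousLinearMap.id ℝ E) with hD
  have hD0 : 0 ≤ D := mul_nonneg zero_le_two (frobeniusNormSq_nonneg _)
  set K' : ℝ := 2 * |K| + D + 1 with hK'
  have hK'0 : 0 ≤ K' := by positivity
  -- the penalisation weight `δ` and the penalised function `v`
  obtain ⟨δ, hδ, hδlt⟩ : ∃ δ : ℝ, 0 < δ ∧ δ * (‖y‖ ^ 2 + K' * (s - s₁)) < w s y - M₁ := by
    have hq : 0 ≤ ‖y‖ ^ 2 + K' * (s - s₁) := by nlinarith [sq_nonneg ‖y‖, sub_nonneg.2 hs.1]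
    refine ⟨(w s y - M₁) / (2 * (‖y‖ ^ 2 + K' * (s - s₁) + 1)), div_pos (by linarith)
      (by positivity), ?_⟩
    rw [div_mul_eq_mul_div, div_lt_iff₀ (by positivity)]
    nlinarith
  set v : ℝ → E → ℝ := fun σ z => w σ z - δ * (‖z‖ ^ 2 + K' * (σ - s₁)) with hv
  have hvsy : M₁ < v s y := by simp only [hv]; linarith
  have hvle : ∀ σ ∈ Icc s₁ s₂, ∀ z, v σ z ≤ A - δ * ‖z‖ ^ 2 := fun σ hσ z => by
    have h2 : 0 ≤ δ * (K' * (σ - s₁)) := mul_nonneg hδ.le (mul_nonneg hK'0 (sub_nonneg.2 hσ.1))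
    simp only [hv]
    nlinarith [hA σ hσ z]
  -- a radius beyond which `v < v s y`
  set R : ℝ := ‖y‖ + (|A| + |v s y|) / δ + 1 with hR
  have hq0 : 0 ≤ (|A| + |v s y|) / δ := by positivity
  have hRy : ‖y‖ ≤ R := by simp only [hR]; linarith
  have hR1 : 1 ≤ R := by simp only [hR]; linarith [norm_nonneg y]
  have hRδ : |A| + |v s y| ≤ δ * R := by
    rw [← div_le_iff₀' hδ]; simp only [hR]; linarith [norm_nonneg y]
  have hout : ∀ σ ∈ Icc s₁ s₂, ∀ z, R < ‖z‖ → v σ z < v s y := fun σ hσ z hz => by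
    have h2 : δ * R < δ * ‖z‖ ^ 2 := by
      refine mul_lt_mul_of_pos_left ?_ hδ
      nlinarith [mul_self_lt_mul_self (by linarith) hz]
    linarith [hvle σ hσ z, le_abs_self A, neg_abs_le (v s y)]
  -- the maximum of `v` over the compact cylinder is a maximum over the slab
  set Kc : Set (ℝ × E) := Icc s₁ s₂ ×ˢ closedBall (0 : E) R with hKc
  have hsyK : (s, y) ∈ Kc := ⟨hs, by simpa using hRy⟩
  have hvcont : ContinuousOn (uncurry v) Kc := by
    have hpen : Continuous fun p : ℝ × E => δ * (‖p.2‖ ^ 2 + K' * (p.1 - s₁)) := by fun_prop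
    exact (hcont.sub hpen.continuousOn).mono (prod_mono Subset.rfl (subset_univ _))
  obtain ⟨⟨s', y'⟩, hpK, hpmax⟩ :=
    (isCompact_Icc.prod (isCompact_closedBall 0 R)).exists_isMaxOn ⟨(s, y), hsyK⟩ hvcont
  have hs' : s' ∈ Icc s₁ s₂ := hpK.1
  have hglob : ∀ σ ∈ Icc s₁ s₂, ∀ z, v σ z ≤ v s' y' := fun σ hσ z => by
    by_cases hz : ‖z‖ ≤ R
    · exact hpmax (a := (σ, z)) ⟨hσ, by simpa using hz⟩
    · exact ((hout σ hσ z (not_le.1 hz)).trans_le (hpmax hsyK)).le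
  -- the maximum is not on the initial slice
  have hvs'y' : M₁ < v s' y' := hvsy.trans_le (hpmax hsyK)
  have hs'Ioc : s' ∈ Ioc s₁ s₂ := by
    refine ⟨lt_of_le_of_ne hs'.1 fun h => ?_, hs'.2⟩
    have h1 : v s' y' ≤ M₁ := by
      simp only [hv, ← h, sub_self, mul_zero, add_zero]
      nlinarith [hM₁ y', sq_nonneg ‖y'‖]
    linarith
  -- spatial first/second-order conditions at `y'`
  have hVC2 : ContDiff ℝ 2 (v s') :=
    (hC2 s' hs'Ioc).sub (contDiff_const.mul ((contDiff_norm_sq ℝ).add contDiff_const))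
  have hVmax : IsLocalMax (v s') y' := Filter.Eventually.of_forall fun z => hglob s' hs' z
  have hVder : HasFDerivAt (v s') (fderiv ℝ (w s') y' - δ • (2 • innerSL ℝ y')) y' :=
    ((hC2 s' hs'Ioc).differentiable (by norm_num) y').hasFDerivAt.sub
      (((hasStrictFDerivAt_norm_sq y').hasFDerivAt.add_const _).const_mul δ)
  have hgrad : fderiv ℝ (w s') y' (b s' y') = 2 * δ * ⟪y', b s' y'⟫ := by
    rw [sub_eq_zero.1 (hVmax.hasFDerivAt_eq_zero hVder)]
    simp [two_smul]
    ring
  have hlap : (Δ (w s')) y' ≤ δ * D := by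
    have h0 := laplacian_nonpos_of_isLocalMax hVC2 hVmax
    have hpenC2 : ContDiff ℝ 2 fun z : E => δ * (‖z‖ ^ 2 + K' * (s' - s₁)) :=
      contDiff_const.mul ((contDiff_norm_sq ℝ).add contDiff_const)
    have h1 : (Δ (v s')) y' = (Δ (w s')) y' - (Δ fun z : E => δ * (‖z‖ ^ 2 + K' * (s' - s₁))) y' :=
      (hC2 s' hs'Ioc).contDiffAt.laplacian_sub hpenC2.contDiffAt
    have h2 : (Δ fun z : E => δ * (‖z‖ ^ 2 + K' * (s' - s₁))) y' = δ * D := by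
      have e1 : (fun z : E => δ * (‖z‖ ^ 2 + K' * (s' - s₁))) =
          δ • ((fun z : E => ‖z‖ ^ 2) + fun _ : E => K' * (s' - s₁)) := by
        funext z; simp [smul_eq_mul]
      have hC : ContDiffAt ℝ 2 ((fun z : E => ‖z‖ ^ 2) + fun _ : E => K' * (s' - s₁)) y' :=
        ((contDiff_norm_sq ℝ).add contDiff_const).contDiffAt
      rw [e1, laplacian_smul _ hC,
        (contDiff_norm_sq ℝ (n := 2)).contDiffAt.laplacian_add contDiff_const.contDiffAt,
        laplacian_const, Pi.zero_apply, add_zero, laplacian_norm_sq_eq_const, smul_eq_mul]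
    linarith
  -- temporal condition at `s'`
  have htime : δ * K' ≤ deriv (fun σ => w σ y') s' := by
    have hpt : HasDerivAt (fun σ : ℝ => δ * (‖y'‖ ^ 2 + K' * (σ - s₁))) (δ * (K' * 1)) s' := by
      simpa using (((hasDerivAt_id s').sub_const s₁).const_mul K').const_add (‖y'‖ ^ 2)
        |>.const_mul δ
    have := deriv_nonneg_of_isMaxOn_Icc hs'Ioc.1 (fun σ hσ => hglob σ ⟨hσ.1, hσ.2.trans hs'.2⟩ y')
      ((hdiff s' hs'Ioc y').hasDerivAt.sub hpt)
    linarith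
  -- contradiction with the subsolution inequality at `(s', y')`
  have hsub' := hsub s' hs'Ioc y'
  rw [hgrad, real_inner_comm] at hsub'
  have hKK : K' - 2 * K - D ≥ 1 := by simp only [hK']; linarith [le_abs_self K]
  nlinarith [hdrift s' hs'Ioc y', mul_pos hδ (show (0:ℝ) < 1 by norm_num)]

omit [FiniteDimensional ℝ E] in
/-- A vector identity: with `Ω' = P + L − a − ½Q − R`,
`⟪a, Ω'⟫ + (⟪a, R⟫ + ⟪a, ½Q⟫) − ⟪L, a⟫ = ⟪a, P⟫ − ‖a‖²`. [folklore] -/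
theorem noSlack_inner_identity (a L P Q R : E) :
    ⟪a, P + L - a - (1 / 2 : ℝ) • Q - R⟫ + (⟪a, R⟫ + ⟪a, (1 / 2 : ℝ) • Q⟫) - ⟪L, a⟫ =
      ⟪a, P⟫ - ‖a‖ ^ 2 := by
  rw [real_inner_comm a L, ← real_inner_self_eq_norm_sq]
  simp only [inner_add_right, inner_sub_right, inner_smul_right]
  ring

/-- **Subsolution computation**: if `Ω' + Ω + ½∇Ω y + ∇Ω U = ∇U Ω + ΔΩ` at `(s, y)` and
`⟪∇U Ω, Ω⟫ ≤ (1 − ε)‖Ω‖²`, then `w = e^{2εs}‖Ω‖²` has `∂ₛw + Dw[U + ½y] − Δw ≤ 0` at `(s, y)`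
(`Δ‖Ω‖² = 2⟪ΔΩ, Ω⟫ + 2|∇Ω|² ≥ 2⟪ΔΩ, Ω⟫`). [folklore] -/
theorem noSlack_subsolution_core {Ω U : ℝ → E → E} {ε s : ℝ} {y Ω' : E}
    (hderΩ : HasDerivAt (fun σ => Ω σ y) Ω' s) (hslice : ContDiff ℝ 2 (Ω s))
    (heq : Ω' + Ω s y + (1 / 2 : ℝ) • fderiv ℝ (Ω s) y y + fderiv ℝ (Ω s) y (U s y) =
      fderiv ℝ (U s) y (Ω s y) + (Δ (Ω s)) y)
    (hS : ⟪fderiv ℝ (U s) y (Ω s y), Ω s y⟫ ≤ (1 - ε) * ‖Ω s y‖ ^ 2) :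
    HasDerivAt (fun σ => Real.exp (2 * ε * σ) * ‖Ω σ y‖ ^ 2)
        (deriv (fun σ => Real.exp (2 * ε * σ) * ‖Ω σ y‖ ^ 2) s) s ∧
      deriv (fun σ => Real.exp (2 * ε * σ) * ‖Ω σ y‖ ^ 2) s
          + fderiv ℝ (fun z => Real.exp (2 * ε * s) * ‖Ω s z‖ ^ 2) y (U s y + (1 / 2 : ℝ) • y)
          - (Δ fun z => Real.exp (2 * ε * s) * ‖Ω s z‖ ^ 2) y ≤ 0 := by
  have hw := hasDerivAt_exp_mul_norm_sq (2 * ε) hderΩ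
  refine ⟨hw.differentiableAt.hasDerivAt, ?_⟩
  rw [hw.deriv, fderiv_const_mul_norm_sq_apply _ (hslice.differentiable (by norm_num) y),
    laplacian_const_mul_norm_sq _ hslice, map_add, map_smul]
  have heq' : Ω' = fderiv ℝ (U s) y (Ω s y) + (Δ (Ω s)) y - Ω s y
      - (1 / 2 : ℝ) • fderiv ℝ (Ω s) y y - fderiv ℝ (Ω s) y (U s y) := by rw [← heq]; abel
  have key : ⟪Ω s y, Ω'⟫ + (⟪Ω s y, fderiv ℝ (Ω s) y (U s y)⟫
      + ⟪Ω s y, (1 / 2 : ℝ) • fderiv ℝ (Ω s) y y⟫) - ⟪(Δ (Ω s)) y, Ω s y⟫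
      = ⟪Ω s y, fderiv ℝ (U s) y (Ω s y)⟫ - ‖Ω s y‖ ^ 2 := by
    rw [heq']; exact noSlack_inner_identity _ _ _ _ _
  rw [real_inner_comm] at hS
  rw [inner_add_right]
  nlinarith [frobeniusNormSq_nonneg (fderiv ℝ (Ω s) y), Real.exp_pos (2 * ε * s),
    mul_nonneg (Real.exp_pos (2 * ε * s)).le (frobeniusNormSq_nonneg (fderiv ℝ (Ω s) y))]

end Generic

section Similarity

/-- Physical space `ℝ³`. -/
local notation "ℝ³" => EuclideanSpace ℝ (Fin 3)

variable {C : ℝ} {u : ℝ → ℝ³ → ℝ³}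

/-- The similarity vorticity `Ω = lerayVorticity u` is jointly smooth on `ℝ × ℝ³`. [folklore] -/
theorem noSlack_contDiff_uncurry_lerayVorticity (h : IsTypeIAncientMild C u) :
    ContDiff ℝ ∞ (uncurry (lerayVorticity u)) := by
  have hU : IsSmoothSpaceTimeOn univ (lerayOrbit u) :=
    (contDiff_uncurry_lerayOrbit h.contDiffOn).contDiffOn
  have hΩ := hU.isSmoothSpaceTimeOn_vorticity uniqueDiffOn_univ
  have hv : vorticity (lerayOrbit u) = lerayVorticity u := by
    funext σ z; rw [lerayVorticity_apply, vorticity_apply]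
  unfold IsSmoothSpaceTimeOn at hΩ
  rw [hv, univ_prod_univ] at hΩ
  exact contDiffOn_univ.1 hΩ

/-- **The stretching hypothesis in similarity variables**: `⟪∇U(s,y) v, v⟫ ≤ (1 − ε)‖v‖²`
(`∇U(s,y) = (−t)∇u(t,x)`, `fderiv_lerayOrbit`). [folklore] -/
theorem noSlack_inner_fderiv_lerayOrbit_le {ε : ℝ}
    (hst : ∀ t < 0, ∀ (x e : ℝ³), ‖e‖ = 1 → (-t) * ⟪fderiv ℝ (u t) x e, e⟫ ≤ 1 - ε)
    (s : ℝ) (y v : ℝ³) : ⟪fderiv ℝ (lerayOrbit u s) y v, v⟫ ≤ (1 - ε) * ‖v‖ ^ 2 := by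
  by_cases hv : v = 0
  · simp [hv]
  have hn : 0 < ‖v‖ := norm_pos_iff.2 hv
  set e : ℝ³ := ‖v‖⁻¹ • v with he
  have he1 : ‖e‖ = 1 := by rw [he, norm_smul, norm_inv, norm_norm, inv_mul_cancel₀ hn.ne']
  have hve : v = ‖v‖ • e := by rw [he, smul_smul, mul_inv_cancel₀ hn.ne', one_smul]
  have key :=
    hst (-Real.exp (-s)) (by simpa using Real.exp_pos (-s)) (Real.exp (-s / 2) • y) e he1
  rw [neg_neg] at key
  rw [fderiv_lerayOrbit, hve]
  simp only [FunLike.coe_smul, Pi.smul_apply, map_smul, inner_smul_left,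
    inner_smul_right, norm_smul, Real.norm_eq_abs, abs_norm, he1, mul_one, conj_trivial]
  have : ‖v‖ * (‖v‖ * (Real.exp (-s) *
      ⟪fderiv ℝ (u (-Real.exp (-s))) (Real.exp (-s / 2) • y) e, e⟫)) ≤ ‖v‖ * (‖v‖ * (1 - ε)) := by
    gcongr
  nlinarith [this]

/-- **The weighted enstrophy density is a subsolution**: for `Ω = lerayVorticity u`,
`U = lerayOrbit u`, `w(s,y) = e^{2εs}‖Ω(s,y)‖²`: `∂ₛw + Dw[U + ½y] − Δw ≤ 0` on `ℝ × ℝ³`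
(`IsTypeIAncientMild.lerayVorticity_eq` and `noSlack_subsolution_core`). [folklore] -/
theorem noSlack_subsolution (h : IsTypeIAncientMild C u) {ε : ℝ}
    (hst : ∀ t < 0, ∀ (x e : ℝ³), ‖e‖ = 1 → (-t) * ⟪fderiv ℝ (u t) x e, e⟫ ≤ 1 - ε)
    (s : ℝ) (y : ℝ³) :
    HasDerivAt (fun σ => Real.exp (2 * ε * σ) * ‖lerayVorticity u σ y‖ ^ 2)
        (deriv (fun σ => Real.exp (2 * ε * σ) * ‖lerayVorticity u σ y‖ ^ 2) s) s ∧
      deriv (fun σ => Real.exp (2 * ε * σ) * ‖lerayVorticity u σ y‖ ^ 2) s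
          + fderiv ℝ (fun z => Real.exp (2 * ε * s) * ‖lerayVorticity u s z‖ ^ 2) y
              (lerayOrbit u s y + (1 / 2 : ℝ) • y)
          - (Δ fun z => Real.exp (2 * ε * s) * ‖lerayVorticity u s z‖ ^ 2) y ≤ 0 := by
  have hΩs := noSlack_contDiff_uncurry_lerayVorticity h
  have hline : ContDiff ℝ ∞ fun σ => lerayVorticity u σ y := by
    have e : (fun σ => lerayVorticity u σ y) = uncurry (lerayVorticity u) ∘ fun σ => (σ, y) := rfl
    rw [e]; exact hΩs.comp (contDiff_id.prodMk contDiff_const)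
  have hslice : ContDiff ℝ 2 (lerayVorticity u s) := by
    have e : lerayVorticity u s = uncurry (lerayVorticity u) ∘ fun z => (s, z) := rfl
    rw [e]; exact (hΩs.of_le (by norm_cast)).comp (contDiff_const.prodMk contDiff_id)
  have heq := h.lerayVorticity_eq s y
  rw [timeDerivWithin_apply, derivWithin_univ, convect_apply, convect_apply] at heq
  exact noSlack_subsolution_core ((hline.differentiable (by simp)) s).hasDerivAt hslice heq
    (noSlack_inner_fderiv_lerayOrbit_le hst s y _)

/-- **The similarity vorticity of a no-slack element vanishes**: `w = e^{2εs}‖Ω‖² ≤ e^{2εs}B²`,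
`B = ‖curl‖K₀` (gauge gradient bound), is a bounded subsolution with confining drift, so
`slab_max_principle` on `[s₁, s]` gives `w(s, y) ≤ e^{2εs₁}B² → 0` as `s₁ → −∞`. [folklore] -/
theorem noSlack_lerayVorticity_eq_zero (h : IsTypeIAncientMild C u) {ε : ℝ} (hε : 0 < ε)
    (hst : ∀ t < 0, ∀ (x e : ℝ³), ‖e‖ = 1 → (-t) * ⟪fderiv ℝ (u t) x e, e⟫ ≤ 1 - ε)
    (s : ℝ) (y : ℝ³) : lerayVorticity u s y = 0 := by
  -- the gauge vorticity bound `‖Ω‖ ≤ B`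
  obtain ⟨K₀, hK₀⟩ := exists_gauge_norm_fderiv_le_of_typeI C
  set B : ℝ := ‖curlCLM‖ * K₀ with hB
  have hΩB : ∀ σ z, ‖lerayVorticity u σ z‖ ≤ B := fun σ z => by
    have key := hK₀ h (-Real.exp (-σ)) (by simpa using Real.exp_pos (-σ)) (Real.exp (-σ / 2) • z)
    rw [neg_neg] at key
    rw [lerayVorticity_apply, curl_lerayOrbit, norm_smul, Real.norm_of_nonneg (Real.exp_pos _).le]
    calc _ ≤ Real.exp (-σ) *
          (‖curlCLM‖ * ‖fderiv ℝ (u (-Real.exp (-σ))) (Real.exp (-σ / 2) • z)‖) :=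
          mul_le_mul_of_nonneg_left (norm_curl_le _ _) (Real.exp_pos _).le
      _ ≤ B := by rw [hB, mul_left_comm]; exact mul_le_mul_of_nonneg_left key (norm_nonneg curlCLM)
  -- the weighted density `w`, its bounds, continuity and slices
  set w : ℝ → ℝ³ → ℝ := fun σ z => Real.exp (2 * ε * σ) * ‖lerayVorticity u σ z‖ ^ 2 with hw
  have hwle : ∀ σ z, w σ z ≤ Real.exp (2 * ε * σ) * B ^ 2 := fun σ z =>
    mul_le_mul_of_nonneg_left (pow_le_pow_left₀ (norm_nonneg _) (hΩB σ z) 2) (Real.exp_pos _).le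
  have hmono : ∀ σ₁ σ₂ : ℝ, σ₁ ≤ σ₂ →
      Real.exp (2 * ε * σ₁) * B ^ 2 ≤ Real.exp (2 * ε * σ₂) * B ^ 2 := fun σ₁ σ₂ h12 =>
    mul_le_mul_of_nonneg_right (Real.exp_le_exp.2 (by nlinarith)) (sq_nonneg _)
  have hΩs := noSlack_contDiff_uncurry_lerayVorticity h
  have hwc : Continuous (uncurry w) :=
    (Real.continuous_exp.comp (continuous_const.mul continuous_fst)).mul (hΩs.continuous.norm.pow 2)
  have hslice : ∀ σ, ContDiff ℝ 2 (w σ) := fun σ => by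
    have e : lerayVorticity u σ = uncurry (lerayVorticity u) ∘ fun z => (σ, z) := rfl
    have h2 : ContDiff ℝ 2 (lerayVorticity u σ) := by
      rw [e]; exact (hΩs.of_le (by norm_cast)).comp (contDiff_const.prodMk contDiff_id)
    exact contDiff_const.mul (h2.norm_sq ℝ)
  -- the drift `U + ½y` is confining: `⟪U + ½z, z⟫ ≥ −C²/2` since `‖U‖ ≤ C`
  have hdrift : ∀ σ (z : ℝ³), -(C ^ 2 / 2) ≤ ⟪lerayOrbit u σ z + (1 / 2 : ℝ) • z, z⟫ := by
    intro σ z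
    have hU := mustSqueeze_norm_lerayOrbit_le h σ z
    have h1 : -(‖lerayOrbit u σ z‖ * ‖z‖) ≤ ⟪lerayOrbit u σ z, z⟫ :=
      neg_le_of_abs_le (abs_real_inner_le_norm _ _)
    rw [inner_add_left, real_inner_smul_left, real_inner_self_eq_norm_sq]
    nlinarith [sq_nonneg (‖z‖ - C), norm_nonneg z, norm_nonneg (lerayOrbit u σ z)]
  -- the maximum principle on every slab `[s₁, s]`, then `s₁ → −∞`
  have hmp : ∀ s₁ ≤ s, w s y ≤ Real.exp (2 * ε * s₁) * B ^ 2 := fun s₁ hs₁ =>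
    slab_max_principle (b := fun σ z => lerayOrbit u σ z + (1 / 2 : ℝ) • z)
      hwc.continuousOn (fun σ _ => hslice σ)
      (fun σ _ z => (noSlack_subsolution h hst σ z).1.differentiableAt)
      (fun σ _ z => (noSlack_subsolution h hst σ z).2) (fun σ _ z => hdrift σ z)
      (fun σ hσ z => (hwle σ z).trans (hmono σ s hσ.2)) (fun z => hwle s₁ z) s
      (right_mem_Icc.2 hs₁) y
  have hlim : Tendsto (fun s₁ : ℝ => Real.exp (2 * ε * s₁) * B ^ 2) atBot (𝓝 0) := by
    have h1 : Tendsto (fun s₁ : ℝ => 2 * ε * s₁) atBot atBot :=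
      tendsto_id.const_mul_atBot (by positivity)
    simpa using (Real.tendsto_exp_atBot.comp h1).mul_const (B ^ 2)
  have hw0 : w s y ≤ 0 :=
    ge_of_tendsto hlim ((eventually_le_atBot s).mono fun s₁ hs₁ => hmp s₁ hs₁)
  have hsq : ‖lerayVorticity u s y‖ ^ 2 ≤ 0 := by
    have : w s y = Real.exp (2 * ε * s) * ‖lerayVorticity u s y‖ ^ 2 := rfl
    nlinarith [sq_nonneg ‖lerayVorticity u s y‖, Real.exp_pos (2 * ε * s)]
  exact norm_eq_zero.1 (pow_eq_zero_iff two_ne_zero |>.1 (le_antisymm hsq (sq_nonneg _)))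

end Similarity

/-- **stub_noSlackStretching** (line `oseen-shell-polar-tomography` of crux
`ExtremalBiaxialitySubcritical`) — NO SLACK: an element `u` of the Type-I KNSS-mild class whose
Leray-gauge stretching rate `(−t)⟪∇u(t,x)e, e⟫` is `≤ 1 − ε` for all `t < 0`, `x`, unit `e`
(`ε > 0`) vanishes identically. The similarity vorticity vanishes by the vorticity maximum
principle (`noSlack_lerayVorticity_eq_zero`: subsolution `e^{2εs}‖Ω‖²`, gauge gradient bound
`exists_gauge_norm_fderiv_le_of_typeI` = KNSS Prop. 4.1/(4.10), slab maximum principle), hence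
`curl u(t,·) = 0` (`Ω(s,y) = (−t)curl u(t,x)`, the similarity map being onto the past); bounded
div/curl-free slices are constant (`eq_of_curl_eq_zero_of_isDivFree_of_bounded`, KNSS Lemma 3.1)
and slice-constant elements vanish in the KNSS gauge (`IsTypeIAncientMild.eq_zero_of_slice_const`,
KNSS Remark 6.1). [cite: KochNadirashviliSereginSverak2009, Prop. 4.1 (4.10), Lemma 3.1, Remark 6.1 and proof of Thm. 5.1 (arXiv:0709.3599v1 pp. 7–11)] -/
theorem stub_noSlackStretching :
    ∀ (C : ℝ) (u : ℝ → EuclideanSpace ℝ (Fin 3) → EuclideanSpace ℝ (Fin 3)), IsTypeIAncientMild C u → ∀ ε : ℝ, 0 < ε → (∀ t < 0, ∀ (x e : EuclideanSpace ℝ (Fin 3)), ‖e‖ = 1 → (-t) * inner ℝ (fderiv ℝ (u t) x e) e ≤ 1 - ε) → ∀ t < 0, ∀ x : EuclideanSpace ℝ (Fin 3), u t x = 0 := by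
  intro C u hu ε hε hst t ht x
  -- `curl u(t, ·) = 0`: read `Ω = 0` at `s = −log(−t)`, `y = x/√(−t)`
  have hcurl : ∀ t < 0, ∀ x, curl (u t) x = 0 := fun t ht x => by
    have key := noSlack_lerayVorticity_eq_zero hu hε hst (-Real.log (-t))
      ((Real.exp (-(-Real.log (-t)) / 2))⁻¹ • x)
    rw [lerayVorticity_apply, curl_lerayOrbit, smul_smul, mul_inv_cancel₀ (Real.exp_pos _).ne',
      one_smul, neg_neg, Real.exp_log (neg_pos.2 ht), neg_neg, smul_eq_zero] at key
    exact key.resolve_left (neg_pos.2 ht).ne'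
  have hconst : ∀ t < 0, ∀ x, u t x = u t 0 := fun t ht x =>
    eq_of_curl_eq_zero_of_isDivFree_of_bounded ((hu.contDiff_slice ht).of_le (by norm_cast))
      (hcurl t ht) (hu.isDivFree ht) (fun z => hu.norm_le ht z) x 0
  exact hu.eq_zero_of_slice_const (b := fun t => u t 0) hconst ht x

end Summit.NavierStokesRegularity.NavierStokesRegularity.Theorems

end
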